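import Literature.MathematicalPhysics.QuantumFieldTheory.Balaban1983to89.B14RegularSpaces234Gauge
import Literature.MathematicalPhysics.QuantumFieldTheory.Balaban1983to89.B15ComplexSpaces

/-!
# `Balaban1983to89.B15RegularSpaces164` — T. Bałaban, *Large field renormalization. I. The basic step of the 𝐑 operation*,
Commun. Math. Phys. **122** (1989) 175–202 [Balaban1989LargeFieldI]: the complex regularity spaces `Ũ^{(n)c}_k(X, α̃₀, α̃₁)` of
pp. 190–191, (1.64)–(1.69), AS SETS of pairs `(𝕌, 𝕁)` — print's preamble and the three conditions (i) (1.64)/(1.65), (ii) (1.66)/(1.67),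
(iii) (1.68)/(1.69) as CONCRETE membership predicates over the carriers of `B12RegularSpaces111` / `B14RegularSpaces234` (the typing of
[I] (1.10)–(1.16) and of [III] (2.34)–(2.39)), every printed bound being the row's letter `B15.ComplexSpaces.Clause164` BY NAME at print's
instance; PROVED: membership unfolding, the p. 191 sentence «for j ≤ k₀ … the point (ii) is empty, no powers of L₀ in (i)», positivity of
the printed factor for `0 ≤ β ≤ 1/4` and monotonicity of the spaces in `(α̃₀, α̃₁)`, the `n = 0` sentence as the factor identity
`lfFactor β h h m k = 1 − β(1 − 2^{−(k−m)})` plus the located inclusion of the `n = 0` space into the [III] space `Ũ^c_k` of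
`B14RegularSpaces234`, and the sentence «invariant with respect to G-valued gauge transformations»

HONEST FRAMING (cell `lit-balaban`, verbatim): statement-level skeleton of published theorems with citation tags; proofs where landed; nothing here is a claim about the Yang–Mills mass gap.

PDF held: `paper:balaban1989-cmp122-large-field-i` (journal page = PDF page + 174); read from the page renders
`b2b-balaban-ref1/pages/1989-cmp122-large-field-I/1989-cmp122-large-field-I-p016-x2.png` (p. 190) and `…-p017-x2.png` (p. 191), as images
(the text layer garbles the displays); [III] = [Balaban1988Convergent] p. 261 from `…1988-cmp119-convergent-renormalization-p019-x2.png`.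

WHAT IS REPRODUCED.  SKELETON row `B15.Eq1.64–1.69` («DEF complex spaces Ũ^{(n)c}_k(X, α̃₀, α̃₁): seven quantities < (1 − βΣ2^{−|m−i|} −
βΣ2^{−(q−m)})L₀^{…}·[units], cube conditions (1.65), (1.67), (1.69)»), until now carried by the verbatim real-letter clauses of
`B15.ComplexSpaces` Part A (`Clause164`, `W164`, `Clause166`, `W166`, `Clause168`, `cConst`, `Cube165`; the factor `B15.BasicStep.lfFactor`) —
the member named by the lead's head word Q-B15-r11-3 (RULING G.5-61 (4)): «a member [that] builds the spaces as sets of (complex, chart-)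
configurations with those clauses as defining conditions and identifies print's instance»; cells for row `B15.Claim@191` (the p. 191 sentences
that are statements about these sets; the omitted DESCENT argument stays `B15.ComplexSpaces` Parts B–D).

THE PRINT, verbatim (p. 190, after «They are modelled on the definition (1.24) of the characteristic functions χ^{(n)}_k and on the definition
of the spaces Ũ^c_k(X, α̃₀, α̃₁).»).  *«The space Ũ^{(n)c}_k(X, α̃₀, α̃₁), for one of the domains X in the representation (1.63), is the set of
configurations (𝕌, 𝕁) defined on X, such that 𝕌 = U′U, U has values in the group G, U′ = exp iηA′, A′ and 𝕁 have values in the complex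
algebra gᶜ. For any cube □ from the family of cubes described below there exists a gauge transformation u defined on □∩X, and such that
U^u = exp iηA, A has values in the algebra g. The configurations 𝕌, U_{p,X}(M˙(𝕌)) = U(𝔹_p(X)∪{Γ_i^{(n)}}_{i<p}, M˙(𝕌)), 𝕁, J_{p,X}(M˙(𝕌)),
U, A′, and A satisfy the following conditions:  (i) |∂𝕌 − 1|, |∂U_{p,X}(M˙(𝕌)) − 1|, |𝕁|, |J_{p,X}(M˙(𝕌))|, |∂U − 1|, |A′|, |∇^η_U A′| <
(1 − β Σ_{i=h+1}^{j} 2^{−|m−i|} − β Σ_{q=m+1}^{k} 2^{−(q−m)}) L₀^{2max{0,m−k₀}}·[α_{0,m}η²(L^mη)^{−2}, α_{0,m}L^{−2p}(L^mL^{−p})^{−2},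
α_{0,m}(L^mη)^{−3}, α_{0,m}L^{m−min{p,m}}(L^mL^{−p})^{−3}, α_{0,m}η²(L^mη)^{−2}, α_{1,m}(L^mη)^{−1}, α_{1,m}(L^mη)^{−2}]  (1.64)  on
(Ω″_m∖Ω″_{m+1})∩X for m = 1,…,j−1, and on (Ω″_j∖Ω_{k₀+1})∩X for m = j, p = 1,…,k,  L^mη|A|, (L^mη)²|∇^ηA| < L₀^{2max{0,m−k₀}}BCMα_{0,m}
(1.65) for □ ⊂ Ω″_m, □∩Ω″^c_{m+1} ≠ ∅ if m = 1,…,j−1, and for □ ⊂ Ω″_j, □∩Ω^c_{k₀+1} ≠ ∅ if m = j, □ is of the size CML^mη.  (ii) [the same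
seven quantities] < (1 − β Σ_{i=h+1}^{j} 2^{−|j−i|} − β Σ_{q=j+1}^{k} 2^{−(q−j)}) L₀^{2(j−m)}·[α_{0,j}η²(L^jη)^{−2}, α_{0,j}L^{−2p}(L^jL^{−p})^{−2},
α_{0,j}(L^jη)^{−3}, α_{0,j}L^{j−min{p,j}}(L^jL^{−p})^{−3}, α_{0,j}η²(L^jη)^{−2}, α_{1,j}(L^jη)^{−1}, α_{1,j}(L^jη)^{−2}]  (1.66)  on (Ω_m∖Ω_{m+1})∩X
for m = k₀+1,…,j−1, j,  L^jη|A|, (L^jη)²|∇^ηA| < L₀^{2(j−m)}BCMα_{0,j}  (1.67)  for □ ⊂ Ω_m, □∩Ω^c_{m+1} ≠ ∅, □ is of the size CML^jη,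
m = k₀+1,…,j−1, j.»*  p. 191: *«(iii) |∂𝕌 − 1|, |∂U_{p,X}(M˙(𝕌)) − 1|, |𝕁|, |𝕁_{p,X}(M˙(𝕌))| [sic: (i), (ii) print J_{p,X}], |∂U − 1|, |A′|,
|∇^η_U A′| < (1 − β Σ_{i=h+1}^{j} 2^{−|m−i|} − β Σ_{q=m+1}^{k} 2^{−(q−m)})·c[α_{0,m}η²(L^mη)^{−2}, …, α_{1,m}(L^mη)^{−2}]  (1.68)  on (Ω_m∖Ω_{m+1})∩X
for m = j+1,…,k−1, and on Ω_k∩X for m = k, where c = 1 for m < k, and c = 3 for m = k,  L^mη|A|, (L^mη)²|∇^ηA| < BCMα_{0,m}  (1.69)  for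
□ ⊂ Ω_m, □∩Ω^c_{m+1} ≠ ∅ if m = j+1,…,k−1, and for □ ⊂ Ω_k if m = k, □ is of the size CML^mη. The constant C above is a positive integer.
It is usually small, because of geometric constraints on the cubes, for example we can assume that C ≤ 2. The constant B is a fixed absolute
constant, for example we can take the constant B = B₃ from Theorem 1 [16]. … It has been written for the case where j > k₀. For j ≤ k₀ it is
simpler, there are no powers of L₀ in the point (i), and the point (ii) is empty. … They are invariant with respect to G-valued gauge
transformations. For n = j − h = 0 the above space coincides with the space Ũ^c_k(X, α̃₀, α̃₁). They form a descending sequence for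
increasing n, if β and L₀ satisfy certain conditions, for example if β ≤ 1/4 and L₀² ≤ (1/3)L.»*

THE TYPING (carriers OF RECORD, nothing re-declared).  (a) Exactly as `B14RegularSpaces234` types [III] (2.34)–(2.39): pairs
`(𝕌, 𝕁) = Setup.FieldPair P i 𝔸ˣ 𝔸` at a lattice level `i` (the `η`-lattice), values in a complete normed `ℂ`-algebra `𝔸`; the value data
`G ≤ 𝔸ˣ`, `Gᶜ ≤ 𝔸ˣ`, `𝔤ᶜ ≤ 𝔸` of `B12RegularSpaces111.Model` EXTENDED by the real algebra `𝔤` of «A has values in the algebra g» (`CModel`);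
`∂U(p)` = `plaq`, `U^u` = `gaugeU`, `∇^η_U` = `nabla`, `∇^η` = `grad`, `exp iηA` = `expI`, «𝕌 = U′U, U′ = exp iηA′» = `Factors`; the sequences
`α̃₀ = {α_{0,m}}`, `α̃₁ = {α_{1,m}}` are functions `ℕ → ℝ`; the indices `k` (the step), `h = k − N`, `j = h + n`, `k₀ = k − N₀` and the reals
`η = L^{−k}`, `L`, `L₀`, `β`, `B`, `C`, `M` are the record `CConsts`.  (b) GEOMETRY AND THE FUNCTIONS OF (i) AS DATA (DIVERGENCE F5, as
`MSFrame`): a `CFrame` = the region `X`, the three families of layer regions on which (1.64)/(1.66)/(1.68) are imposed — (i) `m ↦ (Ω″_m∖Ω″_{m+1})∩X`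
(`m < j`), `(Ω″_j∖Ω_{k₀+1})∩X` (`m = j`); (ii) `m ↦ (Ω_m∖Ω_{m+1})∩X`; (iii) `m ↦ (Ω_m∖Ω_{m+1})∩X` (`m < k`), `Ω_k∩X` (`m = k`) — the three
families of cube regions `□∩X` of (1.65)/(1.67)/(1.69), and the functions `𝕌 ↦ U_{p,X}(M˙(𝕌))`, `𝕌 ↦ J_{p,X}(M˙(𝕌))` each on its own lattice
level with the three layer families of THAT lattice (`CBackgroundFns`, extending `MSBackgroundFns`, whose field `layer` is family (i)).
(c) The seven printed units are the reals `uPlaq`, `uPlaqP`, `uJ`, `uJP`, `uPlaq`, `uA`, `uDA` (in the order of the printed list); ONE RUNG of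
bounds — the seven quantities on a layer region, each `< lfFactor β h j s k · W · [unit at scale s]`, i.e. the letter `Clause164 q β h j s k W E`
BY NAME, together with the cube clause on the cubes of that rung — is the structure `Rung`; the three conditions are `CondI164` (rungs
`m = 1, …, j`, `s = m`, `W = W164 L₀ m k₀` in the bounds and in (1.65)), `CondII166` (rungs `m = k₀+1, …, j`, `s = j` — the DIAGONAL factor and
the units at scale `j` — `W = W166 L₀ j m`; this IS `Clause166`, `rungII_iff_clause166`), `CondIII168` (rungs `m = j+1, …, k`, `s = m`,
`W = cConst m k` in the bounds — this IS `Clause168` — and NO weight in (1.69)); `Satisfies164` = print's preamble («𝕁 ∈ 𝔤ᶜ on X», and for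
some factorisation `𝕌 = (exp iηA′)U`: «U ∈ G on X», «A′ ∈ 𝔤ᶜ on X», (i), (ii), (iii)); **`space164` = `Ũ^{(n)c}_k(X, α̃₀, α̃₁)`** = the SET of
such pairs («is the set of configurations»).  READINGS made explicit (none changes a printed bound): the displays are typed AS WRITTEN («for
the case where j > k₀»; the regions being data, the frame of a case `j ≤ k₀` carries whatever regions print's «simpler» case means, and the
typed (ii) is then empty and the typed (i) weightless — `condII166_of_le`, `condI164_iff_of_le`); the `u` of the cube clauses is typed
`G`-valued and everywhere defined as in (I.1.12) / `B14RegularSpaces234.CondII238` (its values off `□∩X` are never used); the bounds `|A′| <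
F·W·α_{1,s}(L^sη)^{−1}`, `|∇^η_U A′| < F·W·α_{1,s}(L^sη)^{−2}` are typed as printed (not pre-multiplied as in [III] (2.39); `mul_lt_of_uA`,
`mul_lt_of_uDA` convert); `p = 1, …, k` as printed; `𝕌 ∈ Gᶜ` is NOT a clause here (print does not state it on p. 190; it follows from
«𝕌 = (exp iηA′)U» in models with `exp(i𝔤ᶜ)G ⊆ Gᶜ`, hypotheses `hexp`, `hGGc` of §6).
PROVED here: `mem_space164_iff`; `condII166_of_le` / `condI164_iff_of_le` (p. 191 «For j ≤ k₀ …»); `lfFactor_pos` (`0 < lfFactor β h j m k`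
for `0 ≤ β ≤ 1/4`: the first printed sum is `< 3`, the second `< 1`) and `rung_mono`, `satisfies164_mono`, **`space164_mono`** (monotone in
`(α̃₀, α̃₁)` pointwise; `L, η > 0`, `BCM ≥ 0`); `lfFactor_zero` (`n = 0`: the factor IS [III]'s `B14Radii.shrink β (k − m)`) and
**`space164_zero_subset_space234`**: for `j = h < k`, `h ≤ k₀`, the `n = 0` space is contained in `B14RegularSpaces234.space234` of the MERGED
frame (`CFrame.merge`: [III]'s layer `m` = family (i) for `m ≤ h`, family (iii) for `m > h`) with [III]'s constants `(j, ξ) := (k, η)` and the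
sequences multiplied by print's `c` at the top scale (`cTop`), under the model hypotheses `G ≤ Gᶜ`, `exp(iη𝔤ᶜ) ⊆ Gᶜ`; §7 **`act_mem_space164_iff`**:
«invariant with respect to G-valued gauge transformations», condition by condition, under the standing model hypotheses of
`B12RegularSpaces111Gauge` / `B14RegularSpaces234Gauge` (`‖·‖ ≤ 1` on `G`, `𝔤ᶜ` `Ad(G)`-stable) and the gauge covariance of the data
`U_{p,X}(M˙(·))`, `J_{p,X}(M˙(·))` (hypotheses, as there); §8 `unitPair_mem_space164` (NON-VACUITY: the unit pair `(1, 0)` is a member for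
`0 ≤ β ≤ 1/4`, `L, η, L₀, BCM > 0`, positive sequences, when the data send the unit configuration to `1` / `0`, as in `B14RegularSpaces234Inner`).
HONEST SCOPE (located, not smoothed).  (1) p. 191 «For n = j − h = 0 the above space coincides with the space Ũ^c_k(X, α̃₀, α̃₁)»: relative to
the tree's typing of [III] (2.34)–(2.39) (`B14RegularSpaces234`) two printed differences remain at `n = 0` — the factor `c = 3` of (1.68) at
`m = k` ([III] (2.34)–(2.37), (2.39) at `n = j` have factor `1`) and the clause «A has values in the algebra g» of the cube gauges ([III] (2.38)
has none) — so what is PROVED is the inclusion `space164 ⊆ space234(…, c·α̃₀, c·α̃₁)`, not an equality; the cube families also differ in print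
([III]: «□ ⊂ Ω_n∖Ω_{n+2}», (1.69): «□ ⊂ Ω_m») and are data on both sides.  (2) The descent («descending sequence … β ≤ 1/4 and L₀² ≤ (1/3)L»)
and the «stronger statement» are NOT touched (row B15.Claim@191: `B15.ComplexSpaces` Parts B–E, kernel arithmetic under a located error
model).  (3) The constructions `𝔹_p(X)`, `Γ_i^{(n)}`, `M˙`, `U(𝔹, ·)` are data (rows B15.Eq1.19–1.20 / B14.Eq2.10–2.16; `B15DeterminingSets`,
`B14Eq213DetSet`); analyticity of anything is not here.  No `Prop` placeholder, no new fact; axioms standard.  Unit `lit-balaban-p29` (Phase-2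
seat p29 gen 42; TAKING line HOME/STATUS.md 2026-08-25T04:02:20Z), HOME `run/shared/lean/pub/lit-balaban/`.
-/

namespace Literature.MathematicalPhysics.QuantumFieldTheory.Balaban1983to89.B15RegularSpaces164

open Literature.MathematicalPhysics.QuantumFieldTheory.Balaban1983to89
open Literature.MathematicalPhysics.QuantumFieldTheory.Balaban1983to89.B12RegularSpaces111
open Literature.MathematicalPhysics.QuantumFieldTheory.Balaban1983to89.B12RegularSpaces111Gauge
open Literature.MathematicalPhysics.QuantumFieldTheory.Balaban1983to89.B14Radii
open Literature.MathematicalPhysics.QuantumFieldTheory.Balaban1983to89.B14RegularSpaces234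
open Literature.MathematicalPhysics.QuantumFieldTheory.Balaban1983to89.B15.ComplexSpaces
open Literature.MathematicalPhysics.QuantumFieldTheory.Balaban1983to89.B15.BasicStep (lfFactor)
open Complex

noncomputable section

/-! ## §1. The constants, the value data, the geometry and the functions of (i) AS DATA -/

/-- The indices and constants of the space `Ũ^{(n)c}_k(X, α̃₀, α̃₁)`: the step `k`, the lowest scale `h = k − N` of the large-field
induction (p. 179), `j = h + n`, `k₀ = k − N₀` (pp. 179, 181), the lattice spacing `η = L^{−k}`, `L`, `L₀` (the powers `L₀^{2max{0,m−k₀}}`,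
`L₀^{2(j−m)}`),
the number `β` of the factor, and the constants `B` («for example … B = B₃ from Theorem 1 [16]»), `C` («a positive integer … we can assume
that C ≤ 2»), `M` of (1.65)/(1.67)/(1.69). [cite: Balaban1989LargeFieldI, (1.64)-(1.69) pp.190–191] -/
structure CConsts where
  /-- `k` (the step) -/
  k : ℕ
  /-- `h = k − N` -/
  h : ℕ
  /-- `j = h + n` -/
  j : ℕ
  /-- `k₀ = k − N₀` -/
  k₀ : ℕ
  /-- `η = L^{−k}` -/
  η : ℝ
  /-- `L` -/
  L : ℝ
  /-- `L₀` -/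
  L₀ : ℝ
  /-- `β` -/
  β : ℝ
  /-- `B` -/
  B : ℝ
  /-- `C` -/
  C : ℝ
  /-- `M` -/
  M : ℝ

/-- The constants of [III] (2.34)–(2.39) underlying the `n = 0` case («For n = j − h = 0 the above space coincides with the space
Ũ^c_k(X, α̃₀, α̃₁)»): `(j, ξ, L, β, B, C, M) := (k, η, L, β, B, C, M)` — the [III] space index is the step `k` and `ξ = L^{−k} = η`.
[cite: Balaban1989LargeFieldI, p.191] -/
def CConsts.toMSConsts (c : CConsts) : MSConsts where
  j := c.k
  ξ := c.η
  L := c.L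
  β := c.β
  B := c.B
  C := c.C
  M := c.M

/-- The constants over `Setup.Params`: `η = Params.eta k = L^{−k}`, `L = Params.L`. [cite: Balaban1989LargeFieldI, (1.64) p.190] -/
def CConsts.ofParams (P : Params) (L₀ β B C M : ℝ) (k h j k₀ : ℕ) : CConsts where
  k := k
  h := h
  j := j
  k₀ := k₀
  η := P.eta k
  L := P.L
  L₀ := L₀
  β := β
  B := B
  C := C
  M := M

/-- The value data: `B12RegularSpaces111.Model` (`G`, `Gᶜ`, `𝔤ᶜ`: «U has values in the group G», «A′ and 𝕁 have values in the complex
algebra gᶜ») extended by the real algebra `𝔤` of «U^u = exp iηA, A has values in the algebra g» (a real subspace of `𝔸`).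
[cite: Balaban1989LargeFieldI, (1.64) p.190] -/
structure CModel (𝔸 : Type*) [Ring 𝔸] [Algebra ℂ 𝔸] extends Model 𝔸 where
  /-- `𝔤` -/
  g : Submodule ℝ 𝔸

/-- The functions of the conditions, «U_{p,X}(M˙(𝕌)) = U(𝔹_p(X)∪{Γ_i^{(n)}}_{i<p}, M˙(𝕌))» and «J_{p,X}(M˙(𝕌))», `p = 1, …, k` — minimal
configurations of the determining sets of the `n`-th step ((1.19)–(1.20), [III] (2.12)–(2.14)) composed with the averages `M˙`, carried as
DATA exactly as `B14RegularSpaces234.MSBackgroundFns` (which this extends: `lvl p` = the lattice level of `U_{p,X}`, `Up`, `Jp`, and `layer` =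
the family (i) `(p, m) ↦ (Ω″_m∖Ω″_{m+1})∩X` / `(Ω″_j∖Ω_{k₀+1})∩X` in THAT lattice), with the two further layer families of (ii) and (iii) in that
lattice. [cite: Balaban1989LargeFieldI, (1.64) p.190] -/
structure CBackgroundFns (P : Params) (i : ℕ) (𝔸 : Type*) [Monoid 𝔸] extends MSBackgroundFns P i 𝔸 where
  /-- `(p, m) ↦ (Ω_m∖Ω_{m+1})∩X` of (ii), in the lattice of `U_{p,X}` -/
  layerII : (p m : ℕ) → Region P (lvl p)
  /-- `(p, m) ↦ (Ω_m∖Ω_{m+1})∩X` (`m < k`), `Ω_k∩X` (`m = k`) of (iii), in the lattice of `U_{p,X}` -/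
  layerIII : (p m : ℕ) → Region P (lvl p)

/-- Everything the definition of `Ũ^{(n)c}_k(X, α̃₀, α̃₁)` uses about `X` and the two sequences of domains `{Ω″_m}`, `{Ω_m}`: the region `X`
(«defined on X»), the layer regions of (1.64) `m ↦ (Ω″_m∖Ω″_{m+1})∩X` (`m = 1, …, j−1`), `(Ω″_j∖Ω_{k₀+1})∩X` (`m = j`), of (1.66)
`m ↦ (Ω_m∖Ω_{m+1})∩X` (`m = k₀+1, …, j`), of (1.68) `m ↦ (Ω_m∖Ω_{m+1})∩X` (`m = j+1, …, k−1`), `Ω_k∩X` (`m = k`); the cube regions `□∩X` of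
(1.65) («□ ⊂ Ω″_m, □∩Ω″^c_{m+1} ≠ ∅ …, □ ⊂ Ω″_j, □∩Ω^c_{k₀+1} ≠ ∅ …, of the size CML^mη»), of (1.67) («□ ⊂ Ω_m, □∩Ω^c_{m+1} ≠ ∅, of the size
CML^jη»), of (1.69) («□ ⊂ Ω_m, □∩Ω^c_{m+1} ≠ ∅ …, □ ⊂ Ω_k if m = k, of the size CML^mη»); and the functions `U_{p,X}`, `J_{p,X}`. Geometry is
data (DIVERGENCE F5). [cite: Balaban1989LargeFieldI, (1.64)-(1.69) pp.190–191] -/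
structure CFrame (P : Params) (i : ℕ) (𝔸 : Type*) [Monoid 𝔸] where
  /-- the localization domain `X` -/
  X : Region P i
  /-- (i): `m ↦ (Ω″_m∖Ω″_{m+1})∩X` (`m < j`), `(Ω″_j∖Ω_{k₀+1})∩X` (`m = j`) -/
  layerI : ℕ → Region P i
  /-- (1.65): `m ↦` the regions `□∩X` of its cubes -/
  cubesI : ℕ → Set (Region P i)
  /-- (ii): `m ↦ (Ω_m∖Ω_{m+1})∩X`, `m = k₀+1, …, j` -/
  layerII : ℕ → Region P i
  /-- (1.67): `m ↦` the regions `□∩X` of its cubes -/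
  cubesII : ℕ → Set (Region P i)
  /-- (iii): `m ↦ (Ω_m∖Ω_{m+1})∩X` (`j < m < k`), `Ω_k∩X` (`m = k`) -/
  layerIII : ℕ → Region P i
  /-- (1.69): `m ↦` the regions `□∩X` of its cubes -/
  cubesIII : ℕ → Set (Region P i)
  /-- `U_{p,X}(M˙(·))`, `J_{p,X}(M˙(·))` with their lattices and the three layer families -/
  bg : CBackgroundFns P i 𝔸

/-! ## §2. The seven printed units of (1.64) -/

/-- 1st and 5th unit of the printed list: `α_{0,s}η²(L^sη)^{−2}` (for `|∂𝕌 − 1|` and `|∂U − 1|`). [cite: Balaban1989LargeFieldI, (1.64) p.190] -/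
def uPlaq (a η L : ℝ) (s : ℕ) : ℝ := a * η ^ 2 * (L ^ s * η) ^ (-2 : ℤ)

/-- 2nd unit: `α_{0,s}L^{−2p}(L^sL^{−p})^{−2}` (for `|∂U_{p,X}(M˙(𝕌)) − 1|`). [cite: Balaban1989LargeFieldI, (1.64) p.190] -/
def uPlaqP (a L : ℝ) (s p : ℕ) : ℝ := a * L ^ (-(2 * (p : ℤ))) * (L ^ s * L ^ (-(p : ℤ))) ^ (-2 : ℤ)

/-- 3rd unit: `α_{0,s}(L^sη)^{−3}` (for `|𝕁|`). [cite: Balaban1989LargeFieldI, (1.64) p.190] -/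
def uJ (a η L : ℝ) (s : ℕ) : ℝ := a * (L ^ s * η) ^ (-3 : ℤ)

/-- 4th unit: `α_{0,s}L^{s−min{p,s}}(L^sL^{−p})^{−3}` (for `|J_{p,X}(M˙(𝕌))|`). [cite: Balaban1989LargeFieldI, (1.64) p.190] -/
def uJP (a L : ℝ) (s p : ℕ) : ℝ := a * L ^ ((s : ℤ) - ((min p s : ℕ) : ℤ)) * (L ^ s * L ^ (-(p : ℤ))) ^ (-3 : ℤ)

/-- 6th unit: `α_{1,s}(L^sη)^{−1}` (for `|A′|`). [cite: Balaban1989LargeFieldI, (1.64) p.190] -/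
def uA (a η L : ℝ) (s : ℕ) : ℝ := a * (L ^ s * η) ^ (-1 : ℤ)

/-- 7th unit: `α_{1,s}(L^sη)^{−2}` (for `|∇^η_U A′|`). [cite: Balaban1989LargeFieldI, (1.64) p.190] -/
def uDA (a η L : ℝ) (s : ℕ) : ℝ := a * (L ^ s * η) ^ (-2 : ℤ)

/-- The letter of the row, unfolded: `Clause164 q β h j m k W E` IS `q < lfFactor β h j m k · W · E`. [cite: Balaban1989LargeFieldI, (1.64) p.190] -/
theorem clause164_iff (q β : ℝ) (h j m k : ℕ) (W E : ℝ) : Clause164 q β h j m k W E ↔ q < lfFactor β h j m k * W * E :=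
  Iff.rfl

/-- `|A′| < r·α(L^sη)^{−1}` gives the pre-multiplied form `L^sη|A′| < r·α` of [III] (2.39) (`L^sη > 0`). [cite: Balaban1989LargeFieldI, (1.64) p.190] -/
theorem mul_lt_of_uA {L η : ℝ} {s : ℕ} (hpos : 0 < L ^ s * η) {q r a : ℝ} (hq : q < r * uA a η L s) :
    L ^ s * η * q < r * a := by
  have h := mul_lt_mul_of_pos_left hq hpos
  have hne : L ^ s * η ≠ 0 := hpos.ne'
  have hinv : L ^ s * η * (L ^ s * η)⁻¹ = 1 := mul_inv_cancel₀ hne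
  have e : L ^ s * η * (r * uA a η L s) = r * a := by
    unfold uA
    rw [zpow_neg_one]
    linear_combination (r * a) * hinv
  linarith [e]

/-- `|∇^η_U A′| < r·α(L^sη)^{−2}` gives `(L^sη)²|∇^η_U A′| < r·α` (`L^sη > 0`). [cite: Balaban1989LargeFieldI, (1.64) p.190] -/
theorem mul_lt_of_uDA {L η : ℝ} {s : ℕ} (hpos : 0 < L ^ s * η) {q r a : ℝ} (hq : q < r * uDA a η L s) :
    (L ^ s * η) ^ 2 * q < r * a := by
  have h2 : 0 < (L ^ s * η) ^ 2 := pow_pos hpos 2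
  have h := mul_lt_mul_of_pos_left hq h2
  have e : (L ^ s * η) ^ 2 * (r * uDA a η L s) = r * a := by
    unfold uDA
    have hne : (L ^ s * η) ^ 2 ≠ 0 := h2.ne'
    have hinv : (L ^ s * η) ^ 2 * ((L ^ s * η) ^ 2)⁻¹ = 1 := mul_inv_cancel₀ hne
    rw [show ((L ^ s * η) ^ (-2 : ℤ)) = ((L ^ s * η) ^ 2)⁻¹ by rw [zpow_neg, zpow_ofNat]]
    linear_combination (r * a) * hinv
  linarith [e]

/-! ## §3. One rung of bounds; the three conditions (i) (1.64)/(1.65), (ii) (1.66)/(1.67), (iii) (1.68)/(1.69); the space -/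

section Conditions

variable {P : Params} {i : ℕ} {𝔸 : Type*} [NormedRing 𝔸] [NormedAlgebra ℂ 𝔸] [CompleteSpace 𝔸]
variable (𝓜 : CModel 𝔸)

/-- **One rung** of the conditions: the seven printed quantities `|∂𝕌 − 1|`, `|∂U_{p,X}(M˙(𝕌)) − 1|` (`p = 1, …, k`, in the lattice of
`U_{p,X}`), `|𝕁|`, `|J_{p,X}(M˙(𝕌))|`, `|∂U − 1|`, `|A′|`, `|∇^η_U A′|` on the layer region `R` (resp. `Rp p`) bounded by
`lfFactor β h j s k · Wb · [unit at scale s]` — each line the letter `Clause164 q β h j s k Wb E` — and, on every cube region `□∩X ∈ Cs` of the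
rung, a `G`-valued gauge transformation `u` and an `A` with values in `𝔤` with `U^u = exp iηA`, `L^sη|A|, (L^sη)²|∇^ηA| < Wc·BCMα_{0,s}`.
(i): `s = m`, `Wb = Wc = L₀^{2max{0,m−k₀}}`; (ii): `s = j`, `Wb = Wc = L₀^{2(j−m)}`; (iii): `s = m`, `Wb = c`, `Wc = 1`.
[cite: Balaban1989LargeFieldI, (1.64)-(1.69) pp.190–191] -/
structure Rung (F : CFrame P i 𝔸) (c : CConsts) (α₀ α₁ : ℕ → ℝ) (R : Region P i) (Rp : (p : ℕ) → Region P (F.bg.lvl p))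
    (Cs : Set (Region P i)) (s : ℕ) (Wb Wc : ℝ) (U : PBond P i → 𝔸ˣ) (A' : PBond P i → 𝔸) (Φ : FieldPair P i 𝔸ˣ 𝔸) :
    Prop where
  /-- `|∂𝕌 − 1| < F·W·α_{0,s}η²(L^sη)^{−2}` on `R` -/
  plaqU_lt : ∀ q ∈ R.plaqs, Clause164 ‖(↑(plaq Φ.U q) : 𝔸) - 1‖ c.β c.h c.j s c.k Wb (uPlaq (α₀ s) c.η c.L s)
  /-- `|∂U_{p,X}(M˙(𝕌)) − 1| < F·W·α_{0,s}L^{−2p}(L^sL^{−p})^{−2}` on `Rp p`, `p = 1, …, k` -/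
  plaqP_lt : ∀ p, 1 ≤ p → p ≤ c.k → ∀ q ∈ (Rp p).plaqs,
    Clause164 ‖(↑(plaq (F.bg.Up p Φ.U) q) : 𝔸) - 1‖ c.β c.h c.j s c.k Wb (uPlaqP (α₀ s) c.L s p)
  /-- `|𝕁| < F·W·α_{0,s}(L^sη)^{−3}` on `R` -/
  J_lt : ∀ b ∈ R.bonds, Clause164 ‖Φ.J b‖ c.β c.h c.j s c.k Wb (uJ (α₀ s) c.η c.L s)
  /-- `|J_{p,X}(M˙(𝕌))| < F·W·α_{0,s}L^{s−min{p,s}}(L^sL^{−p})^{−3}` on `Rp p`, `p = 1, …, k` -/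
  JP_lt : ∀ p, 1 ≤ p → p ≤ c.k → ∀ b ∈ (Rp p).bonds, Clause164 ‖F.bg.Jp p Φ.U b‖ c.β c.h c.j s c.k Wb (uJP (α₀ s) c.L s p)
  /-- `|∂U − 1| < F·W·α_{0,s}η²(L^sη)^{−2}` on `R` -/
  plaq_lt : ∀ q ∈ R.plaqs, Clause164 ‖(↑(plaq U q) : 𝔸) - 1‖ c.β c.h c.j s c.k Wb (uPlaq (α₀ s) c.η c.L s)
  /-- `|A′| < F·W·α_{1,s}(L^sη)^{−1}` on `R` -/
  A_lt : ∀ b ∈ R.bonds, Clause164 ‖A' b‖ c.β c.h c.j s c.k Wb (uA (α₁ s) c.η c.L s)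
  /-- `|∇^η_U A′| < F·W·α_{1,s}(L^sη)^{−2}` on `R` -/
  dA_lt : ∀ q ∈ R.dpairs,
    Clause164 ‖nabla c.η U q.2.1 (fun y => A' ⟨y, q.2.2⟩) q.1‖ c.β c.h c.j s c.k Wb (uDA (α₁ s) c.η c.L s)
  /-- the cube clause: on each `□∩X` a `G`-valued `u` and a `𝔤`-valued `A` with `U^u = exp iηA`, `L^sη|A|, (L^sη)²|∇^ηA| < Wc·BCMα_{0,s}` -/
  localGauge : ∀ D ∈ Cs, ∃ u : Site P i → 𝔸ˣ, (∀ x, u x ∈ 𝓜.G) ∧ ∃ A : PBond P i → 𝔸,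
    (∀ b ∈ D.bonds, gaugeU u U b = expI c.η (A b)) ∧ (∀ b ∈ D.bonds, A b ∈ 𝓜.g) ∧
      (∀ b ∈ D.bonds, c.L ^ s * c.η * ‖A b‖ < Wc * (c.B * c.C * c.M * α₀ s)) ∧
        ∀ q ∈ D.dpairs, (c.L ^ s * c.η) ^ 2 * ‖grad c.η q.2.1 (fun y => A ⟨y, q.2.2⟩) q.1‖ < Wc * (c.B * c.C * c.M * α₀ s)

/-- **Condition (i)**, (1.64)/(1.65): the rungs `m = 1, …, j` on `(Ω″_m∖Ω″_{m+1})∩X` / `(Ω″_j∖Ω_{k₀+1})∩X` with the factor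
`(1 − βΣ_{i=h+1}^{j}2^{−|m−i|} − βΣ_{q=m+1}^{k}2^{−(q−m)})L₀^{2max{0,m−k₀}}`, units at scale `m`, and (1.65) with the same power of `L₀`.
[cite: Balaban1989LargeFieldI, (1.64)-(1.65) p.190] -/
def CondI164 (F : CFrame P i 𝔸) (c : CConsts) (α₀ α₁ : ℕ → ℝ) (U : PBond P i → 𝔸ˣ) (A' : PBond P i → 𝔸)
    (Φ : FieldPair P i 𝔸ˣ 𝔸) : Prop :=
  ∀ m, 1 ≤ m → m ≤ c.j →
    Rung 𝓜 F c α₀ α₁ (F.layerI m) (fun p => F.bg.layer p m) (F.cubesI m) m (W164 c.L₀ m c.k₀) (W164 c.L₀ m c.k₀) U A' Φ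

/-- **Condition (ii)**, (1.66)/(1.67): the rungs `m = k₀+1, …, j` on `(Ω_m∖Ω_{m+1})∩X` with the DIAGONAL factor
`(1 − βΣ_{i=h+1}^{j}2^{−|j−i|} − βΣ_{q=j+1}^{k}2^{−(q−j)})L₀^{2(j−m)}`, units at scale `j`, and (1.67) with the same power of `L₀`.
[cite: Balaban1989LargeFieldI, (1.66)-(1.67) p.190] -/
def CondII166 (F : CFrame P i 𝔸) (c : CConsts) (α₀ α₁ : ℕ → ℝ) (U : PBond P i → 𝔸ˣ) (A' : PBond P i → 𝔸)
    (Φ : FieldPair P i 𝔸ˣ 𝔸) : Prop :=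
  ∀ m, c.k₀ + 1 ≤ m → m ≤ c.j →
    Rung 𝓜 F c α₀ α₁ (F.layerII m) (fun p => F.bg.layerII p m) (F.cubesII m) c.j (W166 c.L₀ c.j m) (W166 c.L₀ c.j m) U A' Φ

/-- **Condition (iii)**, (1.68)/(1.69): the rungs `m = j+1, …, k` on `(Ω_m∖Ω_{m+1})∩X` / `Ω_k∩X` with the factor
`(1 − βΣ2^{−|m−i|} − βΣ2^{−(q−m)})·c`, «c = 1 for m < k, and c = 3 for m = k», units at scale `m`, and (1.69) WITHOUT weight.
[cite: Balaban1989LargeFieldI, (1.68)-(1.69) p.191] -/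
def CondIII168 (F : CFrame P i 𝔸) (c : CConsts) (α₀ α₁ : ℕ → ℝ) (U : PBond P i → 𝔸ˣ) (A' : PBond P i → 𝔸)
    (Φ : FieldPair P i 𝔸ˣ 𝔸) : Prop :=
  ∀ m, c.j + 1 ≤ m → m ≤ c.k →
    Rung 𝓜 F c α₀ α₁ (F.layerIII m) (fun p => F.bg.layerIII p m) (F.cubesIII m) m (cConst m c.k) 1 U A' Φ

/-- «the set of configurations (𝕌, 𝕁) defined on X, such that 𝕌 = U′U, U has values in the group G, U′ = exp iηA′, A′ and 𝕁 have values in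
the complex algebra gᶜ … [and] the configurations … satisfy the following conditions (i), (ii), (iii)» — with the factorisation witnesses
`U, A′` existentially bound (`Factors`: `𝕌(b) = exp(iηA′(b))U(b)`). [cite: Balaban1989LargeFieldI, (1.64)-(1.69) pp.190–191] -/
def Satisfies164 (F : CFrame P i 𝔸) (c : CConsts) (α₀ α₁ : ℕ → ℝ) (Φ : FieldPair P i 𝔸ˣ 𝔸) : Prop :=
  (∀ b ∈ F.X.bonds, Φ.J b ∈ 𝓜.gc) ∧
    ∃ (U : PBond P i → 𝔸ˣ) (A' : PBond P i → 𝔸), Factors c.toMSConsts.toStepConsts Φ.U U A' ∧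
      (∀ b ∈ F.X.bonds, U b ∈ 𝓜.G) ∧ (∀ b ∈ F.X.bonds, A' b ∈ 𝓜.gc) ∧
        CondI164 𝓜 F c α₀ α₁ U A' Φ ∧ CondII166 𝓜 F c α₀ α₁ U A' Φ ∧ CondIII168 𝓜 F c α₀ α₁ U A' Φ

/-- **The space `Ũ^{(n)c}_k(X, α̃₀, α̃₁)`** (`n = j − h`): «the set of configurations (𝕌, 𝕁) defined on X» satisfying the preamble and
(i)–(iii). [cite: Balaban1989LargeFieldI, (1.64)-(1.69) pp.190–191] -/
def space164 (F : CFrame P i 𝔸) (c : CConsts) (α₀ α₁ : ℕ → ℝ) : Set (FieldPair P i 𝔸ˣ 𝔸) :=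
  {Φ | Satisfies164 𝓜 F c α₀ α₁ Φ}

variable {𝓜}

/-- Membership in `Ũ^{(n)c}_k(X, α̃₀, α̃₁)` IS the defining condition. [cite: Balaban1989LargeFieldI, (1.64)-(1.69) pp.190–191] -/
theorem mem_space164_iff {F : CFrame P i 𝔸} {c : CConsts} {α₀ α₁ : ℕ → ℝ} (Φ : FieldPair P i 𝔸ˣ 𝔸) :
    Φ ∈ space164 𝓜 F c α₀ α₁ ↔ Satisfies164 𝓜 F c α₀ α₁ Φ :=
  Iff.rfl

/-- «the factorisation» of a member: `𝕌(b) = exp(iηA′(b))U(b)` with the `η` of the space. [cite: Balaban1989LargeFieldI, (1.64) p.190] -/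
theorem factors_iff (c : CConsts) (Uc U : PBond P i → 𝔸ˣ) (A' : PBond P i → 𝔸) :
    Factors c.toMSConsts.toStepConsts Uc U A' ↔ ∀ b, Uc b = expI c.η (A' b) * U b :=
  Iff.rfl

/-- A (ii) line IS the letter `Clause166` (diagonal factor, weight `L₀^{2(j−m)}`), e.g. for `|∂𝕌 − 1|`. [cite: Balaban1989LargeFieldI, (1.66) p.190] -/
theorem rungII_iff_clause166 (c : CConsts) (m : ℕ) (q E : ℝ) :
    Clause164 q c.β c.h c.j c.j c.k (W166 c.L₀ c.j m) E ↔ Clause166 q c.β c.h c.j m c.k c.L₀ E :=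
  Iff.rfl

/-- A (iii) line IS the letter `Clause168` (factor `·c`). [cite: Balaban1989LargeFieldI, (1.68) p.191] -/
theorem rungIII_iff_clause168 (c : CConsts) (m : ℕ) (q E : ℝ) :
    Clause164 q c.β c.h c.j m c.k (cConst m c.k) E ↔ Clause168 q c.β c.h c.j m c.k (cConst m c.k) E :=
  Iff.rfl

/-- The two cube bounds of a rung, for a bond `b` and a derivative triple `q` of the cube, ARE the letter `Cube165` at
`(L^sη|A(b)|, (L^sη)²|∇^ηA(q)|)`. [cite: Balaban1989LargeFieldI, (1.65) p.190] -/
theorem cube165_iff (c : CConsts) (s : ℕ) (Wc a₀ nA ndA : ℝ) :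
    Cube165 (c.L ^ s * c.η * nA) ((c.L ^ s * c.η) ^ 2 * ndA) Wc c.B c.C c.M a₀ ↔
      c.L ^ s * c.η * nA < Wc * (c.B * c.C * c.M * a₀) ∧ (c.L ^ s * c.η) ^ 2 * ndA < Wc * (c.B * c.C * c.M * a₀) :=
  Iff.rfl

/-! ## §4. p. 191: «For j ≤ k₀ it is simpler, there are no powers of L₀ in the point (i), and the point (ii) is empty» -/

/-- For `j ≤ k₀` the typed (ii) is EMPTY (no rung `k₀ + 1 ≤ m ≤ j`). [cite: Balaban1989LargeFieldI, p.191] -/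
theorem condII166_of_le {F : CFrame P i 𝔸} {c : CConsts} (hjk : c.j ≤ c.k₀) (α₀ α₁ : ℕ → ℝ) (U : PBond P i → 𝔸ˣ)
    (A' : PBond P i → 𝔸) (Φ : FieldPair P i 𝔸ˣ 𝔸) : CondII166 𝓜 F c α₀ α₁ U A' Φ :=
  fun _ h1 h2 => absurd (le_trans h1 h2) (by omega)

/-- For `j ≤ k₀` the typed (i) carries NO power of `L₀` (`L₀^{2max{0,m−k₀}} = 1` for `m ≤ j ≤ k₀`). [cite: Balaban1989LargeFieldI, p.191] -/
theorem condI164_iff_of_le {F : CFrame P i 𝔸} {c : CConsts} (hjk : c.j ≤ c.k₀) (α₀ α₁ : ℕ → ℝ) (U : PBond P i → 𝔸ˣ)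
    (A' : PBond P i → 𝔸) (Φ : FieldPair P i 𝔸ˣ 𝔸) :
    CondI164 𝓜 F c α₀ α₁ U A' Φ ↔ ∀ m, 1 ≤ m → m ≤ c.j →
      Rung 𝓜 F c α₀ α₁ (F.layerI m) (fun p => F.bg.layer p m) (F.cubesI m) m 1 1 U A' Φ := by
  refine forall_congr' fun m => forall_congr' fun _ => forall_congr' fun hm => ?_
  rw [W164_of_le c.L₀ (le_trans hm hjk)]

end Conditions

/-! ## §5. The printed factor is positive for `0 ≤ β ≤ 1/4`; monotonicity of the spaces in `(α̃₀, α̃₁)` -/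

section Factor

/-- The first printed sum is `< 3`: `Σ_{i=h+1}^{j} 2^{−|m−i|} < Σ_{l ≥ 0} 2^{−l} + Σ_{l ≥ 1} 2^{−l} = 3` (the indices `i ≤ m` and `i > m`
contribute distinct exponents). [cite: Balaban1989LargeFieldI, (1.64) p.190] -/
theorem sum_first_lt_three (h j m : ℕ) :
    ∑ n ∈ Finset.range (j - h), (1 / 2 : ℝ) ^ Int.natAbs ((m : ℤ) - (h + 1 + n : ℕ)) < 3 := by
  classical
  set S := Finset.range (j - h) with hS
  set A := S.filter (fun n => h + 1 + n ≤ m) with hA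
  set B := S.filter (fun n => ¬ (h + 1 + n ≤ m)) with hB
  have hsplit := Finset.sum_filter_add_sum_filter_not S (fun n => h + 1 + n ≤ m)
    (fun n => (1 / 2 : ℝ) ^ Int.natAbs ((m : ℤ) - (h + 1 + n : ℕ)))
  rw [← hsplit]
  -- part A: exponents `m − h − 1 − n`, distinct, `< m − h`
  have hAeq : ∑ n ∈ A, (1 / 2 : ℝ) ^ Int.natAbs ((m : ℤ) - (h + 1 + n : ℕ)) = ∑ n ∈ A, (1 / 2 : ℝ) ^ (m - h - 1 - n) := by
    refine Finset.sum_congr rfl fun n hn => ?_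
    have hn' : h + 1 + n ≤ m := (Finset.mem_filter.mp hn).2
    congr 1
    omega
  have hAinj : Set.InjOn (fun n => m - h - 1 - n) (A : Set ℕ) := by
    intro a ha b hb hab
    have ha' : h + 1 + a ≤ m := (Finset.mem_filter.mp ha).2
    have hb' : h + 1 + b ≤ m := (Finset.mem_filter.mp hb).2
    simp only at hab
    omega
  have hAle : ∑ n ∈ A, (1 / 2 : ℝ) ^ (m - h - 1 - n) ≤ ∑ l ∈ Finset.range (m - h), (1 / 2 : ℝ) ^ l := by
    rw [← Finset.sum_image (f := fun l => (1 / 2 : ℝ) ^ l) hAinj]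
    refine Finset.sum_le_sum_of_subset_of_nonneg ?_ fun l _ _ => by positivity
    intro l hl
    obtain ⟨n, hn, rfl⟩ := Finset.mem_image.mp hl
    have hn' : h + 1 + n ≤ m := (Finset.mem_filter.mp hn).2
    exact Finset.mem_range.mpr (by omega)
  have hA2 : ∑ n ∈ A, (1 / 2 : ℝ) ^ Int.natAbs ((m : ℤ) - (h + 1 + n : ℕ)) < 2 := by
    rw [hAeq]
    refine lt_of_le_of_lt hAle ?_
    rw [sum_half_pow_eq]
    have : 0 < (1 / 2 : ℝ) ^ (m - h) := by positivity
    linarith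
  -- part B: exponents `h + n − m + 1`, distinct, `≥ 1`
  have hBeq : ∑ n ∈ B, (1 / 2 : ℝ) ^ Int.natAbs ((m : ℤ) - (h + 1 + n : ℕ)) = ∑ n ∈ B, (1 / 2 : ℝ) ^ ((h + n - m) + 1) := by
    refine Finset.sum_congr rfl fun n hn => ?_
    have hn' : ¬ h + 1 + n ≤ m := (Finset.mem_filter.mp hn).2
    congr 1
    omega
  have hBinj : Set.InjOn (fun n => h + n - m) (B : Set ℕ) := by
    intro a ha b hb hab
    have ha' : ¬ h + 1 + a ≤ m := (Finset.mem_filter.mp ha).2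
    have hb' : ¬ h + 1 + b ≤ m := (Finset.mem_filter.mp hb).2
    simp only at hab
    omega
  have hBle : ∑ n ∈ B, (1 / 2 : ℝ) ^ ((h + n - m) + 1) ≤ ∑ l ∈ Finset.range (h + (j - h) - m + 1), (1 / 2 : ℝ) ^ (l + 1) := by
    rw [← Finset.sum_image (f := fun l => (1 / 2 : ℝ) ^ (l + 1)) hBinj]
    refine Finset.sum_le_sum_of_subset_of_nonneg ?_ fun l _ _ => by positivity
    intro l hl
    obtain ⟨n, hn, rfl⟩ := Finset.mem_image.mp hl
    have hn' : n ∈ S := (Finset.mem_filter.mp hn).1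
    rw [hS, Finset.mem_range] at hn'
    exact Finset.mem_range.mpr (by omega)
  have hB1 : ∑ n ∈ B, (1 / 2 : ℝ) ^ Int.natAbs ((m : ℤ) - (h + 1 + n : ℕ)) < 1 := by
    rw [hBeq]
    refine lt_of_le_of_lt hBle ?_
    rw [sum_half_pow_succ_eq]
    have : 0 < (1 / 2 : ℝ) ^ (h + (j - h) - m + 1) := by positivity
    linarith
  linarith

/-- The second printed sum is `< 1`: `Σ_{q=m+1}^{k} 2^{−(q−m)} = 1 − 2^{−(k−m)}`. [cite: Balaban1989LargeFieldI, (1.64) p.190] -/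
theorem sum_second_lt_one (m k : ℕ) : ∑ n ∈ Finset.range (k - m), (1 / 2 : ℝ) ^ (n + 1) < 1 := by
  rw [sum_half_pow_succ_eq]
  have : 0 < (1 / 2 : ℝ) ^ (k - m) := by positivity
  linarith

/-- **The printed factor is positive** for `0 ≤ β ≤ 1/4` (print: «for example if β ≤ 1/4»): `1 − βΣ₁ − βΣ₂ > 1 − 4β ≥ 0`.
[cite: Balaban1989LargeFieldI, (1.64) p.190] -/
theorem lfFactor_pos {β : ℝ} (h0 : 0 ≤ β) (h4 : β ≤ 1 / 4) (h j m k : ℕ) : 0 < lfFactor β h j m k := by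
  unfold lfFactor
  have h1 := sum_first_lt_three h j m
  have h2 := sum_second_lt_one m k
  have hS1 : 0 ≤ ∑ n ∈ Finset.range (j - h), (1 / 2 : ℝ) ^ Int.natAbs ((m : ℤ) - (h + 1 + n : ℕ)) :=
    Finset.sum_nonneg fun n _ => by positivity
  have hS2 : 0 ≤ ∑ n ∈ Finset.range (k - m), (1 / 2 : ℝ) ^ (n + 1) := Finset.sum_nonneg fun n _ => by positivity
  nlinarith [mul_nonneg h0 hS1, mul_nonneg h0 hS2]

/-- The weight `L₀^{2max{0,m−k₀}}` is nonnegative (even power). [cite: Balaban1989LargeFieldI, (1.64) p.190] -/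
theorem W164_nonneg (L₀ : ℝ) (m k₀ : ℕ) : 0 ≤ W164 L₀ m k₀ := by
  unfold W164; exact (even_two_mul _).pow_nonneg L₀

/-- The weight `L₀^{2(j−m)}` is nonnegative (even power). [cite: Balaban1989LargeFieldI, (1.66) p.190] -/
theorem W166_nonneg (L₀ : ℝ) (j m : ℕ) : 0 ≤ W166 L₀ j m := by
  unfold W166; exact (even_two_mul _).pow_nonneg L₀

/-- `0 ≤ c` («c = 1 … c = 3»). [cite: Balaban1989LargeFieldI, (1.68) p.191] -/
theorem cConst_nonneg (m k : ℕ) : 0 ≤ cConst m k := le_trans zero_le_one (one_le_cConst m k)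

/-- The units are monotone in their coefficient (`L, η > 0`). [cite: Balaban1989LargeFieldI, (1.64) p.190] -/
theorem units_mono {L η : ℝ} (hL : 0 < L) (hη : 0 < η) {a a' : ℝ} (ha : a ≤ a') (s p : ℕ) :
    uPlaq a η L s ≤ uPlaq a' η L s ∧ uPlaqP a L s p ≤ uPlaqP a' L s p ∧ uJ a η L s ≤ uJ a' η L s ∧
      uJP a L s p ≤ uJP a' L s p ∧ uA a η L s ≤ uA a' η L s ∧ uDA a η L s ≤ uDA a' η L s := by
  have h1 : 0 < L ^ s * η := by positivity
  have h2 : 0 < L ^ s * L ^ (-(p : ℤ)) := mul_pos (by positivity) (zpow_pos hL _)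
  unfold uPlaq uPlaqP uJ uJP uA uDA
  refine ⟨?_, ?_, ?_, ?_, ?_, ?_⟩
  · exact mul_le_mul_of_nonneg_right (mul_le_mul_of_nonneg_right ha (sq_nonneg _)) (zpow_nonneg h1.le _)
  · exact mul_le_mul_of_nonneg_right (mul_le_mul_of_nonneg_right ha (zpow_nonneg hL.le _)) (zpow_nonneg h2.le _)
  · exact mul_le_mul_of_nonneg_right ha (zpow_nonneg h1.le _)
  · exact mul_le_mul_of_nonneg_right (mul_le_mul_of_nonneg_right ha (zpow_nonneg hL.le _)) (zpow_nonneg h2.le _)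
  · exact mul_le_mul_of_nonneg_right ha (zpow_nonneg h1.le _)
  · exact mul_le_mul_of_nonneg_right ha (zpow_nonneg h1.le _)

/-- A clause with a nonnegative factor·weight is monotone in the unit. [cite: Balaban1989LargeFieldI, (1.64) p.190] -/
theorem clause164_mono {q β : ℝ} {h j m k : ℕ} {W E E' : ℝ} (hF : 0 ≤ lfFactor β h j m k) (hW : 0 ≤ W) (hE : E ≤ E')
    (hq : Clause164 q β h j m k W E) : Clause164 q β h j m k W E' :=
  lt_of_lt_of_le hq (mul_le_mul_of_nonneg_left hE (mul_nonneg hF hW))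

end Factor

section Mono

variable {P : Params} {i : ℕ} {𝔸 : Type*} [NormedRing 𝔸] [NormedAlgebra ℂ 𝔸] [CompleteSpace 𝔸]
variable {𝓜 : CModel 𝔸}

/-- One rung is monotone in `(α_{0,s}, α_{1,s})` (factor, weights `≥ 0`, `L, η > 0`, `BCM ≥ 0`): the same `U, A′`, the same cube gauges.
[cite: Balaban1989LargeFieldI, (1.64)-(1.69) pp.190–191] -/
theorem rung_mono {F : CFrame P i 𝔸} {c : CConsts} {α₀ α₀' α₁ α₁' : ℕ → ℝ} {R : Region P i}
    {Rp : (p : ℕ) → Region P (F.bg.lvl p)} {Cs : Set (Region P i)} {s : ℕ} {Wb Wc : ℝ} {U : PBond P i → 𝔸ˣ}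
    {A' : PBond P i → 𝔸} {Φ : FieldPair P i 𝔸ˣ 𝔸} (hF : 0 ≤ lfFactor c.β c.h c.j s c.k) (hWb : 0 ≤ Wb) (hWc : 0 ≤ Wc)
    (hL : 0 < c.L) (hη : 0 < c.η) (hBCM : 0 ≤ c.B * c.C * c.M) (h0 : α₀ s ≤ α₀' s) (h1 : α₁ s ≤ α₁' s)
    (h : Rung 𝓜 F c α₀ α₁ R Rp Cs s Wb Wc U A' Φ) : Rung 𝓜 F c α₀' α₁' R Rp Cs s Wb Wc U A' Φ := by
  have m0 := fun p => units_mono hL hη h0 s p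
  have m1 := fun p => units_mono hL hη h1 s p
  have hcube : Wc * (c.B * c.C * c.M * α₀ s) ≤ Wc * (c.B * c.C * c.M * α₀' s) :=
    mul_le_mul_of_nonneg_left (mul_le_mul_of_nonneg_left h0 hBCM) hWc
  refine ⟨fun q hq => clause164_mono hF hWb (m0 0).1 (h.plaqU_lt q hq),
    fun p hp hpk q hq => clause164_mono hF hWb (m0 p).2.1 (h.plaqP_lt p hp hpk q hq),
    fun b hb => clause164_mono hF hWb (m0 0).2.2.1 (h.J_lt b hb),
    fun p hp hpk b hb => clause164_mono hF hWb (m0 p).2.2.2.1 (h.JP_lt p hp hpk b hb),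
    fun q hq => clause164_mono hF hWb (m0 0).1 (h.plaq_lt q hq),
    fun b hb => clause164_mono hF hWb (m1 0).2.2.2.2.1 (h.A_lt b hb),
    fun q hq => clause164_mono hF hWb (m1 0).2.2.2.2.2 (h.dA_lt q hq), fun D hD => ?_⟩
  obtain ⟨u, hu, A, hg, hA, hb, hd⟩ := h.localGauge D hD
  exact ⟨u, hu, A, hg, hA, fun b hb' => lt_of_lt_of_le (hb b hb') hcube, fun q hq => lt_of_lt_of_le (hd q hq) hcube⟩

/-- The defining condition is monotone in `(α̃₀, α̃₁)` pointwise, for `0 ≤ β ≤ 1/4`, `L, η > 0`, `BCM ≥ 0` (the factor is then positive,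
`lfFactor_pos`; the weights are even powers; `c ≥ 1`). [cite: Balaban1989LargeFieldI, (1.64)-(1.69) pp.190–191] -/
theorem satisfies164_mono {F : CFrame P i 𝔸} {c : CConsts} (hβ0 : 0 ≤ c.β) (hβ4 : c.β ≤ 1 / 4) (hL : 0 < c.L) (hη : 0 < c.η)
    (hBCM : 0 ≤ c.B * c.C * c.M) {α₀ α₀' α₁ α₁' : ℕ → ℝ} (hα₀ : ∀ m, α₀ m ≤ α₀' m) (hα₁ : ∀ m, α₁ m ≤ α₁' m)
    {Φ : FieldPair P i 𝔸ˣ 𝔸} (h : Satisfies164 𝓜 F c α₀ α₁ Φ) : Satisfies164 𝓜 F c α₀' α₁' Φ := by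
  obtain ⟨hJ, U, A', hf, hG, hgc, h1, h2, h3⟩ := h
  have hF := fun s => (lfFactor_pos hβ0 hβ4 c.h c.j s c.k).le
  refine ⟨hJ, U, A', hf, hG, hgc, fun m hm hmj => ?_, fun m hm hmj => ?_, fun m hm hmk => ?_⟩
  · exact rung_mono (hF m) (W164_nonneg _ _ _) (W164_nonneg _ _ _) hL hη hBCM (hα₀ m) (hα₁ m) (h1 m hm hmj)
  · exact rung_mono (hF c.j) (W166_nonneg _ _ _) (W166_nonneg _ _ _) hL hη hBCM (hα₀ c.j) (hα₁ c.j) (h2 m hm hmj)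
  · exact rung_mono (hF m) (cConst_nonneg _ _) zero_le_one hL hη hBCM (hα₀ m) (hα₁ m) (h3 m hm hmk)

/-- **The spaces are monotone in the sequences**: `Ũ^{(n)c}_k(X, α̃₀, α̃₁) ⊆ Ũ^{(n)c}_k(X, α̃₀′, α̃₁′)` for `α̃₀ ≤ α̃₀′`, `α̃₁ ≤ α̃₁′` pointwise
(`0 ≤ β ≤ 1/4`, `L, η > 0`, `BCM ≥ 0`). [cite: Balaban1989LargeFieldI, (1.64)-(1.69) pp.190–191] -/
theorem space164_mono {F : CFrame P i 𝔸} {c : CConsts} (hβ0 : 0 ≤ c.β) (hβ4 : c.β ≤ 1 / 4) (hL : 0 < c.L) (hη : 0 < c.η)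
    (hBCM : 0 ≤ c.B * c.C * c.M) {α₀ α₀' α₁ α₁' : ℕ → ℝ} (hα₀ : ∀ m, α₀ m ≤ α₀' m) (hα₁ : ∀ m, α₁ m ≤ α₁' m) :
    space164 𝓜 F c α₀ α₁ ⊆ space164 𝓜 F c α₀' α₁' :=
  fun _ h => satisfies164_mono hβ0 hβ4 hL hη hBCM hα₀ hα₁ h

end Mono

/-! ## §6. `n = 0`: «For n = j − h = 0 the above space coincides with the space Ũ^c_k(X, α̃₀, α̃₁)» — the factor identity and the
located inclusion into `B14RegularSpaces234.space234` -/

section Zero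

/-- **At `n = 0` (`j = h`) the printed factor IS [III]'s**: `1 − β·(empty sum) − βΣ_{q=m+1}^{k}2^{−(q−m)} = 1 − β(1 − 2^{−(k−m)})` =
`B14Radii.shrink β (k − m)`, the factor of [III] (2.34)–(2.39) with `j := k`. [cite: Balaban1989LargeFieldI, p.191] -/
theorem lfFactor_zero (β : ℝ) (h m k : ℕ) : lfFactor β h h m k = shrink β (k - m) := by
  unfold lfFactor shrink
  rw [Nat.sub_self, Finset.range_zero, Finset.sum_empty, mul_zero, sub_zero, sum_half_pow_succ_eq]

/-- The sequences multiplied by print's `c` at the top scale: `(c·α̃)_m = α_m` for `m < k`, `3α_k` at `m = k`.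
[cite: Balaban1989LargeFieldI, (1.68) p.191] -/
def cTop (k : ℕ) (α : ℕ → ℝ) : ℕ → ℝ := fun m => cConst m k * α m

/-- `(c·α̃)_m = α_m` below the top scale. [cite: Balaban1989LargeFieldI, (1.68) p.191] -/
theorem cTop_of_lt {k m : ℕ} (hm : m < k) (α : ℕ → ℝ) : cTop k α m = α m := by
  unfold cTop cConst; rw [if_pos hm, one_mul]

/-- `α_m ≤ (c·α̃)_m` for `m ≤ k` when `α_k ≥ 0` (`c ≥ 1`). [cite: Balaban1989LargeFieldI, (1.68) p.191] -/
theorem le_cTop {k m : ℕ} (hm : m ≤ k) {α : ℕ → ℝ} (hα : 0 ≤ α k) : α m ≤ cTop k α m := by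
  unfold cTop cConst
  split_ifs with hlt
  · rw [one_mul]
  · obtain rfl : m = k := le_antisymm hm (not_lt.mp hlt)
    linarith

variable {P : Params} {i : ℕ} {𝔸 : Type*}

/-- The [III] frame of the `n = 0` comparison: the SAME `X`, the SAME functions `U_{p,X}`, `J_{p,X}`, and [III]'s single layer / cube family
`m ↦` family (i) for `m ≤ h`, family (iii) for `m > h` (at `n = 0` print's (i) runs over `m = 1, …, h` and (iii) over `m = h+1, …, k`).
[cite: Balaban1989LargeFieldI, p.191] -/
def CFrame.merge [Monoid 𝔸] (F : CFrame P i 𝔸) (h : ℕ) : MSFrame P i 𝔸 where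
  X := F.X
  layer m := if m ≤ h then F.layerI m else F.layerIII m
  cubes m := if m ≤ h then F.cubesI m else F.cubesIII m
  bg :=
    { lvl := F.bg.lvl
      Up := F.bg.Up
      Jp := F.bg.Jp
      layer := fun p m => if m ≤ h then F.bg.layer p m else F.bg.layerIII p m }

variable [NormedRing 𝔸] [NormedAlgebra ℂ 𝔸] [CompleteSpace 𝔸] {𝓜 : CModel 𝔸}

/-- At `n = 0` a rung `s = m ≤ k` of weight `1` (family (i), `m ≤ h ≤ k₀`) or `c` (family (iii)) gives [III]'s bounds (2.34)–(2.39) at layer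
`m` with the coefficients `(c·α̃₀)_m`, `(c·α̃₁)_m` and index `j := k`. [cite: Balaban1989LargeFieldI, p.191] -/
theorem rung_zero_radii {F : CFrame P i 𝔸} {c : CConsts} (hj : c.j = c.h) (hL : 0 < c.L) (hη : 0 < c.η) {α₀ α₁ : ℕ → ℝ}
    {R : Region P i} {Rp : (p : ℕ) → Region P (F.bg.lvl p)} {Cs : Set (Region P i)} {m : ℕ} {Wc : ℝ} {U : PBond P i → 𝔸ˣ}
    {A' : PBond P i → 𝔸} {Φ : FieldPair P i 𝔸ˣ 𝔸} (h : Rung 𝓜 F c α₀ α₁ R Rp Cs m (cConst m c.k) Wc U A' Φ) :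
    (∀ q ∈ R.plaqs, ‖(↑(plaq Φ.U q) : 𝔸) - 1‖ < rad234 c.β (cTop c.k α₀ m) c.η c.L c.k m) ∧
    (∀ p, 1 ≤ p → p ≤ c.k → ∀ q ∈ (Rp p).plaqs,
        ‖(↑(plaq (F.bg.Up p Φ.U) q) : 𝔸) - 1‖ < rad235 c.β (cTop c.k α₀ m) c.L c.k m p) ∧
    (∀ b ∈ R.bonds, ‖Φ.J b‖ < rad236 c.β (cTop c.k α₀ m) c.η c.L c.k m) ∧
    (∀ p, 1 ≤ p → p ≤ c.k → ∀ b ∈ (Rp p).bonds, ‖F.bg.Jp p Φ.U b‖ < rad237 c.β (cTop c.k α₀ m) c.L c.k m p) ∧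
    (∀ q ∈ R.plaqs, ‖(↑(plaq U q) : 𝔸) - 1‖ < rad234 c.β (cTop c.k α₀ m) c.η c.L c.k m) ∧
    (∀ b ∈ R.bonds, c.L ^ m * c.η * ‖A' b‖ < rad239 c.β (cTop c.k α₁ m) c.k m) ∧
    (∀ q ∈ R.dpairs, (c.L ^ m * c.η) ^ 2 * ‖nabla c.η U q.2.1 (fun y => A' ⟨y, q.2.2⟩) q.1‖ < rad239 c.β (cTop c.k α₁ m) c.k m) := by
  have hF : lfFactor c.β c.h c.j m c.k = shrink c.β (c.k - m) := by rw [hj]; exact lfFactor_zero c.β c.h m c.k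
  have hpos : 0 < c.L ^ m * c.η := by positivity
  refine ⟨fun q hq => ?_, fun p hp hpk q hq => ?_, fun b hb => ?_, fun p hp hpk b hb => ?_, fun q hq => ?_, fun b hb => ?_,
    fun q hq => ?_⟩
  · have := h.plaqU_lt q hq
    rw [clause164_iff, hF] at this
    convert this using 1
    unfold rad234 cTop uPlaq; ring
  · have := h.plaqP_lt p hp hpk q hq
    rw [clause164_iff, hF] at this
    convert this using 1
    unfold rad235 cTop uPlaqP; ring
  · have := h.J_lt b hb
    rw [clause164_iff, hF] at this
    convert this using 1
    unfold rad236 cTop uJ; ring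
  · have := h.JP_lt p hp hpk b hb
    rw [clause164_iff, hF] at this
    convert this using 1
    unfold rad237 cTop uJP; ring
  · have := h.plaq_lt q hq
    rw [clause164_iff, hF] at this
    convert this using 1
    unfold rad234 cTop uPlaq; ring
  · have := h.A_lt b hb
    rw [clause164_iff, hF] at this
    have := mul_lt_of_uA hpos this
    convert this using 1
    unfold rad239 cTop; ring
  · have := h.dA_lt q hq
    rw [clause164_iff, hF] at this
    have := mul_lt_of_uDA hpos this
    convert this using 1
    unfold rad239 cTop; ring

/-- A family-(i) rung at `n = 0` (`m ≤ h ≤ k₀`, `m < k`: weight `L₀^{0} = 1 = c`) is a rung of weight `c` in the bounds.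
[cite: Balaban1989LargeFieldI, p.191] -/
theorem rung_zero_I {F : CFrame P i 𝔸} {c : CConsts} (hk₀ : c.h ≤ c.k₀) (hhk : c.h < c.k) {α₀ α₁ : ℕ → ℝ} {R : Region P i}
    {Rp : (p : ℕ) → Region P (F.bg.lvl p)} {Cs : Set (Region P i)} {m : ℕ} (hm : m ≤ c.h) {U : PBond P i → 𝔸ˣ}
    {A' : PBond P i → 𝔸} {Φ : FieldPair P i 𝔸ˣ 𝔸}
    (h : Rung 𝓜 F c α₀ α₁ R Rp Cs m (W164 c.L₀ m c.k₀) (W164 c.L₀ m c.k₀) U A' Φ) :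
    Rung 𝓜 F c α₀ α₁ R Rp Cs m (cConst m c.k) 1 U A' Φ := by
  have hW : W164 c.L₀ m c.k₀ = 1 := W164_of_le c.L₀ (le_trans hm hk₀)
  have hc : cConst m c.k = 1 := by unfold cConst; rw [if_pos (lt_of_le_of_lt hm hhk)]
  rw [hW] at h
  rw [hc]
  exact h

/-- **`n = 0`, the located inclusion**: for `j = h < k`, `h ≤ k₀`, `L, η > 0`, `BCM ≥ 0`, `α_{0,k} ≥ 0`, in a model with `G ≤ Gᶜ` and
`exp(iη𝔤ᶜ) ⊆ Gᶜ`, every member of `Ũ^{(0)c}_k(X, α̃₀, α̃₁)` satisfies [III] (2.34)–(2.39) (`B14RegularSpaces234.Satisfies234`) for the merged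
frame, the constants `(j, ξ) := (k, η)` and the sequences `c·α̃₀`, `c·α̃₁` (print's «coincides», up to the located factor `c = 3` at `m = k`
and the clause «A ∈ 𝔤», see the module docstring). [cite: Balaban1989LargeFieldI, p.191] -/
theorem satisfies234_of_satisfies164_zero {F : CFrame P i 𝔸} {c : CConsts} (hj : c.j = c.h) (hk₀ : c.h ≤ c.k₀) (hhk : c.h < c.k)
    (hL : 0 < c.L) (hη : 0 < c.η) (hBCM : 0 ≤ c.B * c.C * c.M) {α₀ α₁ : ℕ → ℝ} (hα : 0 ≤ α₀ c.k) (hGGc : 𝓜.G ≤ 𝓜.Gc)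
    (hexp : ∀ a ∈ 𝓜.gc, expI c.η a ∈ 𝓜.Gc) {Φ : FieldPair P i 𝔸ˣ 𝔸} (h : Satisfies164 𝓜 F c α₀ α₁ Φ) :
    Satisfies234 𝓜.toModel (F.merge c.h) c.toMSConsts (cTop c.k α₀) (cTop c.k α₁) Φ := by
  obtain ⟨hJ, U, A', hf, hG, hgc, h1, -, h3⟩ := h
  -- the rung of [III]'s layer `m`, `1 ≤ m ≤ k`, read at weight `c` in the bounds and `1` in the cubes
  have hr : ∀ m, 1 ≤ m → m ≤ c.k → Rung 𝓜 F c α₀ α₁ ((F.merge c.h).layer m) (fun p => (F.merge c.h).bg.layer p m)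
      ((F.merge c.h).cubes m) m (cConst m c.k) 1 U A' Φ := by
    intro m hm hmk
    by_cases hmh : m ≤ c.h
    · have e1 : (F.merge c.h).layer m = F.layerI m := if_pos hmh
      have e2 : (fun p => (F.merge c.h).bg.layer p m) = fun p => F.bg.layer p m := funext fun p => if_pos hmh
      have e3 : (F.merge c.h).cubes m = F.cubesI m := if_pos hmh
      rw [e1, e2, e3]
      exact rung_zero_I hk₀ hhk hmh (h1 m hm (hj ▸ hmh))
    · have e1 : (F.merge c.h).layer m = F.layerIII m := if_neg hmh
      have e2 : (fun p => (F.merge c.h).bg.layer p m) = fun p => F.bg.layerIII p m := funext fun p => if_neg hmh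
      have e3 : (F.merge c.h).cubes m = F.cubesIII m := if_neg hmh
      rw [e1, e2, e3]
      exact h3 m (by omega) hmk
  refine ⟨fun b hb => ?_, hJ, U, A', hf, ?_, ?_, ?_⟩
  · rw [hf b]
    exact 𝓜.Gc.mul_mem (hexp _ (hgc b hb)) (hGGc (hG b hb))
  · refine ⟨hG, fun m hm hmk q hq => ?_, fun m hm hmk q hq => ?_, fun p hp hpk m hm hmk q hq => ?_, fun m hm hmk b hb => ?_,
      fun p hp hpk m hm hmk b hb => ?_⟩
    · exact (rung_zero_radii hj hL hη (hr m hm hmk)).2.2.2.2.1 q hq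
    · exact (rung_zero_radii hj hL hη (hr m hm hmk)).1 q hq
    · exact (rung_zero_radii hj hL hη (hr m hm hmk)).2.1 p hp hpk q hq
    · exact (rung_zero_radii hj hL hη (hr m hm hmk)).2.2.1 b hb
    · exact (rung_zero_radii hj hL hη (hr m hm hmk)).2.2.2.1 p hp hpk b hb
  · refine ⟨fun m hm hmk D hD => ?_⟩
    obtain ⟨u, hu, A, hgauge, -, hA, hdA⟩ := (hr m hm hmk).localGauge D hD
    have hle : 1 * (c.B * c.C * c.M * α₀ m) ≤ rad238 c.B c.C c.M (cTop c.k α₀ m) := by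
      rw [one_mul]; unfold rad238
      exact mul_le_mul_of_nonneg_left (le_cTop hmk hα) hBCM
    exact ⟨u, hu, A, hgauge, fun b hb => lt_of_lt_of_le (hA b hb) hle, fun q hq => lt_of_lt_of_le (hdA q hq) hle⟩
  · refine ⟨hgc, fun m hm hmk b hb => ?_, fun m hm hmk q hq => ?_⟩
    · exact (rung_zero_radii hj hL hη (hr m hm hmk)).2.2.2.2.2.1 b hb
    · exact (rung_zero_radii hj hL hη (hr m hm hmk)).2.2.2.2.2.2 q hq

/-- **`Ũ^{(0)c}_k(X, α̃₀, α̃₁) ⊆ Ũ^c_k(X, c·α̃₀, c·α̃₁)`** (the [III] space of `B14RegularSpaces234` for the merged frame and `(j, ξ) := (k, η)`),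
under the hypotheses of `satisfies234_of_satisfies164_zero`. [cite: Balaban1989LargeFieldI, p.191] -/
theorem space164_zero_subset_space234 {F : CFrame P i 𝔸} {c : CConsts} (hj : c.j = c.h) (hk₀ : c.h ≤ c.k₀) (hhk : c.h < c.k)
    (hL : 0 < c.L) (hη : 0 < c.η) (hBCM : 0 ≤ c.B * c.C * c.M) {α₀ α₁ : ℕ → ℝ} (hα : 0 ≤ α₀ c.k) (hGGc : 𝓜.G ≤ 𝓜.Gc)
    (hexp : ∀ a ∈ 𝓜.gc, expI c.η a ∈ 𝓜.Gc) :
    space164 𝓜 F c α₀ α₁ ⊆ space234 𝓜.toModel (F.merge c.h) c.toMSConsts (cTop c.k α₀) (cTop c.k α₁) :=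
  fun _ h => satisfies234_of_satisfies164_zero hj hk₀ hhk hL hη hBCM hα hGGc hexp h

end Zero

/-! ## §7. «They are invariant with respect to G-valued gauge transformations» -/

section Gauge

variable {P : Params} {i : ℕ} {𝔸 : Type*} [NormedRing 𝔸] [NormedAlgebra ℂ 𝔸] [CompleteSpace 𝔸]
variable {𝓜 : CModel 𝔸}

/-- **One rung is `G`-invariant**: `(U, A′, (𝕌, 𝕁)) ↦ (U^v, R(v)A′, (𝕌, 𝕁)^v)` for `G`-valued `v` preserves the seven bounds — given the gauge
covariance of the data `U_{p,X}(M˙(·))`, `J_{p,X}(M˙(·))` at `𝕌` (properties of (1.19)–(1.20), [III] (2.10)–(2.16) in print; hypotheses on the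
data here, as in `B14RegularSpaces234Gauge`) — and the cube clause (local gauge `u ↦ uv⁻¹`, the SAME `A`). [cite: Balaban1989LargeFieldI, p.191] -/
theorem rung_act (hG1 : ∀ g ∈ 𝓜.G, ‖(g : 𝔸)‖ ≤ 1) {F : CFrame P i 𝔸} {c : CConsts} {α₀ α₁ : ℕ → ℝ} {R : Region P i}
    {Rp : (p : ℕ) → Region P (F.bg.lvl p)} {Cs : Set (Region P i)} {s : ℕ} {Wb Wc : ℝ} {U : PBond P i → 𝔸ˣ}
    {A' : PBond P i → 𝔸} {Φ : FieldPair P i 𝔸ˣ 𝔸} {v : Site P i → 𝔸ˣ} (hv : ∀ x, v x ∈ 𝓜.G)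
    (hUp : ∀ p, ∃ w : Site P (F.bg.lvl p) → 𝔸ˣ, (∀ x, w x ∈ 𝓜.G) ∧ F.bg.Up p (gaugeU v Φ.U) = gaugeU w (F.bg.Up p Φ.U))
    (hJp : ∀ p b, ‖F.bg.Jp p (gaugeU v Φ.U) b‖ = ‖F.bg.Jp p Φ.U b‖) (h : Rung 𝓜 F c α₀ α₁ R Rp Cs s Wb Wc U A' Φ) :
    Rung 𝓜 F c α₀ α₁ R Rp Cs s Wb Wc (gaugeU v U) (adJ v A') (act v Φ) := by
  refine ⟨fun q hq => ?_, fun p hp hpk q hq => ?_, fun b hb => ?_, fun p hp hpk b hb => ?_, fun q hq => ?_, fun b hb => ?_,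
    fun q hq => ?_, fun D hD => ?_⟩
  · show Clause164 ‖(↑(plaq (gaugeU v Φ.U) q) : 𝔸) - 1‖ _ _ _ _ _ _ _
    rw [clause164_iff, plaq_gaugeU, Units.val_mul, Units.val_mul, norm_conj_sub_one_eq hG1 (hv q.src)]
    exact h.plaqU_lt q hq
  · show Clause164 ‖(↑(plaq (F.bg.Up p (gaugeU v Φ.U)) q) : 𝔸) - 1‖ _ _ _ _ _ _ _
    obtain ⟨w, hw, hwp⟩ := hUp p
    rw [clause164_iff, hwp, plaq_gaugeU, Units.val_mul, Units.val_mul, norm_conj_sub_one_eq hG1 (hw q.src)]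
    exact h.plaqP_lt p hp hpk q hq
  · show Clause164 ‖adJ v Φ.J b‖ _ _ _ _ _ _ _
    rw [clause164_iff, B14RegularSpaces234Gauge.norm_adJ_eq hG1 hv]
    exact h.J_lt b hb
  · show Clause164 ‖F.bg.Jp p (gaugeU v Φ.U) b‖ _ _ _ _ _ _ _
    rw [clause164_iff, hJp]
    exact h.JP_lt p hp hpk b hb
  · rw [clause164_iff, plaq_gaugeU, Units.val_mul, Units.val_mul, norm_conj_sub_one_eq hG1 (hv q.src)]
    exact h.plaq_lt q hq
  · rw [clause164_iff, B14RegularSpaces234Gauge.norm_adJ_eq hG1 hv]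
    exact h.A_lt b hb
  · rw [clause164_iff, nabla_gaugeU_adJ, norm_conj_eq hG1 (hv _)]
    exact h.dA_lt q hq
  · obtain ⟨u, hu, A, hgauge, hAg, hA, hdA⟩ := h.localGauge D hD
    refine ⟨u * v⁻¹, fun x => 𝓜.G.mul_mem (hu x) (by rw [Pi.inv_apply]; exact 𝓜.G.inv_mem (hv x)), A, ?_, hAg, hA, hdA⟩
    intro b hb
    rw [← gaugeU_mul, inv_mul_cancel_right]
    exact hgauge b hb

/-- **The defining condition is `G`-invariant**: `(𝕌, 𝕁) ↦ (𝕌, 𝕁)^v` for `G`-valued `v` — the factorisation transforms as `U ↦ U^v`,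
`A′ ↦ R(v)A′` (`B12RegularSpaces111Gauge.factors_act`), «U ∈ G», «A′, 𝕁 ∈ 𝔤ᶜ» are kept (`𝔤ᶜ` `Ad(G)`-stable), and every rung is preserved
(`rung_act`). Hypotheses: `‖·‖ ≤ 1` on `G`, `𝔤ᶜ` `Ad(G)`-stable, gauge covariance of the data. [cite: Balaban1989LargeFieldI, p.191] -/
theorem satisfies164_act (hG1 : ∀ g ∈ 𝓜.G, ‖(g : 𝔸)‖ ≤ 1) (hgc : ∀ g ∈ 𝓜.G, ∀ X ∈ 𝓜.gc, (g : 𝔸) * X * ↑g⁻¹ ∈ 𝓜.gc)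
    {F : CFrame P i 𝔸} {c : CConsts} {α₀ α₁ : ℕ → ℝ} {Φ : FieldPair P i 𝔸ˣ 𝔸} {v : Site P i → 𝔸ˣ} (hv : ∀ x, v x ∈ 𝓜.G)
    (hUp : ∀ p, ∃ w : Site P (F.bg.lvl p) → 𝔸ˣ, (∀ x, w x ∈ 𝓜.G) ∧ F.bg.Up p (gaugeU v Φ.U) = gaugeU w (F.bg.Up p Φ.U))
    (hJp : ∀ p b, ‖F.bg.Jp p (gaugeU v Φ.U) b‖ = ‖F.bg.Jp p Φ.U b‖) (h : Satisfies164 𝓜 F c α₀ α₁ Φ) :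
    Satisfies164 𝓜 F c α₀ α₁ (act v Φ) := by
  obtain ⟨hJ, U, A', hf, hG, hgc', h1, h2, h3⟩ := h
  refine ⟨fun b hb => hgc _ (hv _) _ (hJ b hb), gaugeU v U, adJ v A', factors_act v hf,
    fun b hb => 𝓜.G.mul_mem (𝓜.G.mul_mem (hv _) (hG b hb)) (𝓜.G.inv_mem (hv _)), fun b hb => hgc _ (hv _) _ (hgc' b hb),
    fun m hm hmj => rung_act hG1 hv hUp hJp (h1 m hm hmj), fun m hm hmj => rung_act hG1 hv hUp hJp (h2 m hm hmj),
    fun m hm hmk => rung_act hG1 hv hUp hJp (h3 m hm hmk)⟩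

/-- **«They are invariant with respect to G-valued gauge transformations»** (p. 191): for a `G`-valued `v`,
`(𝕌, 𝕁)^v ∈ Ũ^{(n)c}_k(X, α̃₀, α̃₁) ↔ (𝕌, 𝕁) ∈ Ũ^{(n)c}_k(X, α̃₀, α̃₁)` (hypotheses: `‖·‖ ≤ 1` on `G`, `𝔤ᶜ` `Ad(G)`-stable, and the gauge
covariance of the data `U_{p,X}(M˙(·))`, `J_{p,X}(M˙(·))` for all `G`-valued transformations). [cite: Balaban1989LargeFieldI, p.191] -/
theorem act_mem_space164_iff (hG1 : ∀ g ∈ 𝓜.G, ‖(g : 𝔸)‖ ≤ 1) (hgc : ∀ g ∈ 𝓜.G, ∀ X ∈ 𝓜.gc, (g : 𝔸) * X * ↑g⁻¹ ∈ 𝓜.gc)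
    {F : CFrame P i 𝔸} {c : CConsts} {α₀ α₁ : ℕ → ℝ}
    (hUp : ∀ (v : Site P i → 𝔸ˣ), (∀ x, v x ∈ 𝓜.G) → ∀ (V : PBond P i → 𝔸ˣ) p,
      ∃ w : Site P (F.bg.lvl p) → 𝔸ˣ, (∀ x, w x ∈ 𝓜.G) ∧ F.bg.Up p (gaugeU v V) = gaugeU w (F.bg.Up p V))
    (hJp : ∀ (v : Site P i → 𝔸ˣ), (∀ x, v x ∈ 𝓜.G) → ∀ (V : PBond P i → 𝔸ˣ) p b, ‖F.bg.Jp p (gaugeU v V) b‖ = ‖F.bg.Jp p V b‖)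
    (Φ : FieldPair P i 𝔸ˣ 𝔸) {v : Site P i → 𝔸ˣ} (hv : ∀ x, v x ∈ 𝓜.G) :
    act v Φ ∈ space164 𝓜 F c α₀ α₁ ↔ Φ ∈ space164 𝓜 F c α₀ α₁ := by
  refine ⟨fun h => ?_, fun h => satisfies164_act hG1 hgc hv (hUp v hv Φ.U) (hJp v hv Φ.U) h⟩
  have hv' : ∀ x, v⁻¹ x ∈ 𝓜.G := fun x => by rw [Pi.inv_apply]; exact 𝓜.G.inv_mem (hv x)
  have := satisfies164_act hG1 hgc hv' (hUp v⁻¹ hv' (act v Φ).U) (hJp v⁻¹ hv' (act v Φ).U) h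
  rw [act_inv_act] at this
  exact this

end Gauge

/-! ## §8. Non-vacuity: the unit pair `(𝕌, 𝕁) = (1, 0)` -/

section NonVacuity

variable {P : Params} {i : ℕ} {𝔸 : Type*} [NormedRing 𝔸] [NormedAlgebra ℂ 𝔸] [CompleteSpace 𝔸]
variable {𝓜 : CModel 𝔸}

/-- The units are positive for positive coefficient and `L, η > 0`. [cite: Balaban1989LargeFieldI, (1.64) p.190] -/
theorem units_pos {L η a : ℝ} (hL : 0 < L) (hη : 0 < η) (ha : 0 < a) (s p : ℕ) :
    0 < uPlaq a η L s ∧ 0 < uPlaqP a L s p ∧ 0 < uJ a η L s ∧ 0 < uJP a L s p ∧ 0 < uA a η L s ∧ 0 < uDA a η L s := by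
  have h1 : 0 < L ^ s * η := by positivity
  have h2 : 0 < L ^ s * L ^ (-(p : ℤ)) := mul_pos (by positivity) (zpow_pos hL _)
  unfold uPlaq uPlaqP uJ uJP uA uDA
  exact ⟨mul_pos (mul_pos ha (pow_pos hη 2)) (zpow_pos h1 _), mul_pos (mul_pos ha (zpow_pos hL _)) (zpow_pos h2 _),
    mul_pos ha (zpow_pos h1 _), mul_pos (mul_pos ha (zpow_pos hL _)) (zpow_pos h2 _), mul_pos ha (zpow_pos h1 _),
    mul_pos ha (zpow_pos h1 _)⟩

/-- The unit rung: `U = 1`, `A′ = 0`, `(𝕌, 𝕁) = (1, 0)`, local gauges `u = 1`, `A = 0` — every printed strict bound holds with left side `0`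
as soon as the factor, the weights and the coefficients are positive AND the data send the unit configuration to unit / zero configurations
(`U_{p,X}(M˙(1)) = 1`, `J_{p,X}(M˙(1)) = 0`: in print properties of the constructions (1.19)–(1.20), [III] (2.10)–(2.16); hypotheses on the
data here, as in `B14RegularSpaces234Inner.unitPair_mem_space234`). [cite: Balaban1989LargeFieldI, (1.64)-(1.69) pp.190–191] -/
theorem rung_unit {F : CFrame P i 𝔸} {c : CConsts} (hβ0 : 0 ≤ c.β) (hβ4 : c.β ≤ 1 / 4) (hL : 0 < c.L) (hη : 0 < c.η)
    (hBCM : 0 < c.B * c.C * c.M) {α₀ α₁ : ℕ → ℝ} {s : ℕ} (hα₀ : 0 < α₀ s) (hα₁ : 0 < α₁ s) {Wb Wc : ℝ} (hWb : 0 < Wb)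
    (hWc : 0 < Wc) (hUp : ∀ p, F.bg.Up p 1 = 1) (hJp : ∀ p b, F.bg.Jp p 1 b = 0) (R : Region P i)
    (Rp : (p : ℕ) → Region P (F.bg.lvl p)) (Cs : Set (Region P i)) :
    Rung 𝓜 F c α₀ α₁ R Rp Cs s Wb Wc 1 (fun _ => 0) B12RegularSpaces111Mono.unitPair := by
  have hFW : 0 < lfFactor c.β c.h c.j s c.k * Wb := mul_pos (lfFactor_pos hβ0 hβ4 c.h c.j s c.k) hWb
  have hu := fun p => units_pos hL hη hα₀ s p
  have hu1 := fun p => units_pos hL hη hα₁ s p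
  have hplaq : ∀ {l : ℕ} (q : Plaq P l), ‖(↑(plaq (1 : PBond P l → 𝔸ˣ) q) : 𝔸) - 1‖ = 0 := fun q => by
    rw [B12RegularSpaces111Mono.plaq_one, Units.val_one, sub_self, norm_zero]
  have hcube : 0 < Wc * (c.B * c.C * c.M * α₀ s) := mul_pos hWc (mul_pos hBCM hα₀)
  refine ⟨fun q _ => ?_, fun p _ _ q _ => ?_, fun b _ => ?_, fun p _ _ b _ => ?_, fun q _ => ?_, fun b _ => ?_, fun q _ => ?_,
    fun D _ => ?_⟩
  · show Clause164 ‖(↑(plaq (1 : PBond P i → 𝔸ˣ) q) : 𝔸) - 1‖ _ _ _ _ _ _ _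
    rw [clause164_iff, hplaq]; exact mul_pos hFW (hu 0).1
  · show Clause164 ‖(↑(plaq (F.bg.Up p 1) q) : 𝔸) - 1‖ _ _ _ _ _ _ _
    rw [clause164_iff, hUp, hplaq]; exact mul_pos hFW (hu p).2.1
  · show Clause164 ‖(0 : 𝔸)‖ _ _ _ _ _ _ _
    rw [clause164_iff, norm_zero]; exact mul_pos hFW (hu 0).2.2.1
  · show Clause164 ‖F.bg.Jp p 1 b‖ _ _ _ _ _ _ _
    rw [clause164_iff, hJp, norm_zero]; exact mul_pos hFW (hu p).2.2.2.1
  · rw [clause164_iff, hplaq]; exact mul_pos hFW (hu 0).1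
  · rw [clause164_iff, norm_zero]; exact mul_pos hFW (hu1 0).2.2.2.2.1
  · rw [clause164_iff]
    simp only [nabla, mul_zero, zero_mul, sub_self, smul_zero, norm_zero]
    exact mul_pos hFW (hu1 0).2.2.2.2.2
  · refine ⟨1, fun _ => 𝓜.G.one_mem, fun _ => 0, fun b _ => ?_, fun _ _ => 𝓜.g.zero_mem, fun b _ => ?_, fun q _ => ?_⟩
    · rw [B12RegularSpaces111Mono.expI_zero]
      show (1 : Site P i → 𝔸ˣ) b.src * (1 : PBond P i → 𝔸ˣ) b * ((1 : Site P i → 𝔸ˣ) b.tgt)⁻¹ = 1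
      simp
    · rw [norm_zero, mul_zero]; exact hcube
    · simp only [grad, sub_self, smul_zero, norm_zero, mul_zero]; exact hcube

/-- **Non-vacuity of the space**: the unit pair `(1, 0)` (`B12RegularSpaces111Mono.unitPair`) lies in `Ũ^{(n)c}_k(X, α̃₀, α̃₁)` for
`0 ≤ β ≤ 1/4`, `L, η, L₀, BCM > 0`, positive sequences, as soon as the data send the unit configuration to unit / zero configurations.
[cite: Balaban1989LargeFieldI, (1.64)-(1.69) pp.190–191] -/
theorem unitPair_mem_space164 (F : CFrame P i 𝔸) {c : CConsts} (hβ0 : 0 ≤ c.β) (hβ4 : c.β ≤ 1 / 4) (hL : 0 < c.L)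
    (hη : 0 < c.η) (hL₀ : 0 < c.L₀) (hBCM : 0 < c.B * c.C * c.M) {α₀ α₁ : ℕ → ℝ} (hα₀ : ∀ m, 0 < α₀ m) (hα₁ : ∀ m, 0 < α₁ m)
    (hUp : ∀ p, F.bg.Up p 1 = 1) (hJp : ∀ p b, F.bg.Jp p 1 b = 0) :
    (B12RegularSpaces111Mono.unitPair : FieldPair P i 𝔸ˣ 𝔸) ∈ space164 𝓜 F c α₀ α₁ := by
  have hW164 : ∀ m, 0 < W164 c.L₀ m c.k₀ := fun m => by unfold W164; exact pow_pos hL₀ _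
  have hW166 : ∀ m, 0 < W166 c.L₀ c.j m := fun m => by unfold W166; exact pow_pos hL₀ _
  have hc : ∀ m, 0 < cConst m c.k := fun m => lt_of_lt_of_le zero_lt_one (one_le_cConst m c.k)
  refine ⟨fun _ _ => 𝓜.gc.zero_mem, 1, fun _ => 0, B12RegularSpaces111Mono.factors_one c.toMSConsts.toStepConsts,
    fun _ _ => 𝓜.G.one_mem, fun _ _ => 𝓜.gc.zero_mem, fun m _ _ => ?_, fun m _ _ => ?_, fun m _ _ => ?_⟩
  · exact rung_unit hβ0 hβ4 hL hη hBCM (hα₀ m) (hα₁ m) (hW164 m) (hW164 m) hUp hJp _ _ _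
  · exact rung_unit hβ0 hβ4 hL hη hBCM (hα₀ c.j) (hα₁ c.j) (hW166 m) (hW166 m) hUp hJp _ _ _
  · exact rung_unit hβ0 hβ4 hL hη hBCM (hα₀ m) (hα₁ m) (hc m) zero_lt_one hUp hJp _ _ _

end NonVacuity

end

end Literature.MathematicalPhysics.QuantumFieldTheory.Balaban1983to89.B15RegularSpaces164
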